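import Mathlib.Geometry.Manifold.Instances.Real
import Mathlib.Geometry.Manifold.MFDeriv.Basic
import Mathlib.Analysis.InnerProductSpace.PiL2
import Literature.Geometry.Kaehler.ManifoldForms
import HarnessLib

/-!
# Symplectic forms standard near a puncture (packaging for SPC4 / SymplecticCap)

Trunk `Literature/Geometry/Symplectic`; definition request `IsSymplecticStandardNearPoint`
(route `SmoothPoincare4/SymplecticCap`, items `stmt-SmoothPoincare4-0427/0428` and the glue
crux). We package, for a **general** smooth `4`-manifold `M` (charted on `EuclideanSpace ℝ (Fin 4)`,
model `𝓡 4`) and a point `p : M`, the two chart-level predicates that those statements spell out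
verbatim:

* `Literature.SPC4.stdSymplecticForm a b = a₀b₁ - a₁b₀ + a₂b₃ - a₃b₂` — the standard symplectic form
  `ω₀ = dx₀ ∧ dx₁ + dx₂ ∧ dx₃` on `ℝ⁴`;
* `Literature.SPC4.inversion z = ‖z‖⁻² • z` — the inversion `ι` of `ℝ⁴ ∖ 0` (junk `0 ↦ 0`), and
  `Literature.SPC4.invertedStdForm y a b = ω₀(Dι(y) a, Dι(y) b)` — the pulled-back form `ι*ω₀`;
* `Literature.SPC4.punctured p : Opens M` — the open submanifold `M ∖ {p}`;
* **`Literature.SPC4.IsSymplecticStandardNearPoint p ε sf`** — `0 < ε`, and the `2`-form `sf` on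
  `M ∖ {p}` (`Literature.MForm (𝓡 4) (punctured p) ℝ 2`) is smooth, closed, pointwise nondegenerate, and
  on the punctured chart-ball `{x ≠ p | x ∈ (chartAt p).source, e x ∈ ball(e p, ε)}`,
  `e = extChartAt (𝓡 4) p`, equals the pullback along `e` of `ι*ω₀` recentred at `e p`:
  `sf x (v, w) = (ι*ω₀)_{e x - e p}(De v, De w)` — i.e. `(M ∖ p, sf)` is symplectic and *standard
  at infinity* in the chart at `p` (Gromov 1985, §0.3.C: manifolds symplectically asymptotic to
  `(ℝ⁴, ω₀)`; McDuff–Salamon, *J-holomorphic curves and symplectic topology*, 2nd ed. 2012,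
  §9.4);
* **`Literature.SPC4.AgreesWithInvertedChartNear p Φ`** — a map `Φ : M ∖ {p} → ℝ⁴` agrees with the
  inverted recentred chart `ι ∘ (e - e p)` on some punctured chart-ball (the glue crux).

The bodies are *literally* the sub-terms of the signature of `stmt-SmoothPoincare4-0427` (with
`S.carrier` generalised to `M`), so that item reads
`∀ S p, ∃ ε sf, IsSymplecticStandardNearPoint p ε sf` (`isSymplecticStandardNearPoint_iff` is
`Iff.rfl`).

## Design

* Generality: any `M` with `[ChartedSpace (EuclideanSpace ℝ (Fin 4)) M]`; the manifold
  structure `[IsManifold (𝓡 4) ∞ M]` is not needed to *state* the predicates (only `chartAt`,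
  `extChartAt`, `mfderiv`, `TangentSpace` occur) and is therefore not assumed, so that the
  definitions apply verbatim to `S.carrier` for `S : Literature.HomotopySphere 4`.
* Junk: `inversion 0 = 0` (Lean's `0⁻¹ = 0`); it is only evaluated at `e x - e p ≠ 0` for `x ≠ p`
  in the chart source (injectivity of `extChartAt` on its source), as the refuter's audit of 0427
  records.
* Mathlib has no symplectic forms on manifolds (searched `Symplectic` in `Geometry/Manifold`:
  only linear-algebraic `Matrix.symplecticGroup`); forms are the tree's `Literature.Geometry.Kaehler.MForm`,
  `IsSmoothForm`, `IsClosedForm` (`ManifoldForms.lean`).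

## References

* M. Gromov, *Pseudo holomorphic curves in symplectic manifolds*, Invent. Math. 82 (1985),
  307–347, §0.3.C.
* D. McDuff, D. Salamon, *J-holomorphic curves and symplectic topology*, 2nd ed., AMS Colloquium
  Publ. 52 (2012), §9.4.
* D. McDuff, *The structure of rational and ruled symplectic 4-manifolds*, JAMS 3 (1990), Thm 1.7.
-/

noncomputable section

open scoped Manifold ContDiff
open TopologicalSpace Set

namespace Literature.Geometry.Symplectic

/-- Local notation for the model space `ℝ⁴ = EuclideanSpace ℝ (Fin 4)`. -/
local notation "E4" => EuclideanSpace ℝ (Fin 4)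

/-! ### The standard structures on `ℝ⁴` -/

/-- The **standard symplectic form** `ω₀ = dx₀ ∧ dx₁ + dx₂ ∧ dx₃` on `ℝ⁴`, as a function of two
vectors: `ω₀(a, b) = a₀b₁ - a₁b₀ + a₂b₃ - a₃b₂`. [cite: McDuffSalamon2012, §9.4] -/
def stdSymplecticForm (a b : E4) : ℝ :=
  a 0 * b 1 - a 1 * b 0 + a 2 * b 3 - a 3 * b 2

/-- `ω₀` is antisymmetric. [folklore] -/
theorem stdSymplecticForm_swap (a b : E4) : stdSymplecticForm b a = - stdSymplecticForm a b := by
  simp only [stdSymplecticForm]; ring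

/-- `ω₀(a, a) = 0`. [folklore] -/
@[simp] theorem stdSymplecticForm_self (a : E4) : stdSymplecticForm a a = 0 := by
  simp only [stdSymplecticForm]; ring

/-- The **inversion** `ι(z) = z / ‖z‖²` of `ℝ⁴ ∖ {0}` (a diffeomorphism of `ℝ⁴ ∖ 0` exchanging
the ends at `0` and at `∞`); junk value `ι 0 = 0`. [cite: Gromov1985, §0.3.C] -/
def inversion (z : E4) : E4 :=
  (‖z‖ ^ 2)⁻¹ • z

/-- The junk value at the origin. [folklore] -/
@[simp] theorem inversion_zero : inversion 0 = 0 := by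
  simp [inversion]

/-- The pulled-back standard form `(ι*ω₀)_y(a, b) = ω₀(Dι(y) a, Dι(y) b)` at a point `y ∈ ℝ⁴`
(honest Fréchet derivative `fderiv ℝ inversion y`, meaningful for `y ≠ 0`).
[cite: Gromov1985, §0.3.C] -/
def invertedStdForm (y a b : E4) : ℝ :=
  stdSymplecticForm (fderiv ℝ inversion y a) (fderiv ℝ inversion y b)

/-! ### The punctured manifold and the two predicates -/

variable {M : Type*} [TopologicalSpace M]

/-- The open submanifold `M ∖ {p}` as an `Opens M` (points of a charted space over a `T1` model
are closed: `isOpen_compl_singleton` needs `T1Space M`, which every manifold charted on `ℝ⁴`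
enjoys). [folklore] -/
def punctured [T1Space M] (p : M) : Opens M :=
  ⟨{p}ᶜ, isOpen_compl_singleton⟩

/-- Membership in the punctured manifold. [folklore] -/
@[simp] theorem mem_punctured [T1Space M] {p x : M} : x ∈ punctured p ↔ x ≠ p := by
  simp [punctured]

variable [ChartedSpace E4 M] [T1Space M]

/-- `x` lies in the **punctured chart-ball of radius `ε` about `p`**: `x ≠ p` (as a point of
`punctured p`), `x` is in the source of the preferred chart at `p`, and its chart image is within
`ε` of that of `p`. [cite: Gromov1985, §0.3.C] -/
def InPuncturedChartBall (p : M) (ε : ℝ) (x : punctured p) : Prop :=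
  x.1 ∈ (chartAt E4 p).source ∧ extChartAt (𝓡 4) p x.1 ∈ Metric.ball (extChartAt (𝓡 4) p p) ε

/-- **`(M ∖ p, sf)` is symplectic and standard at infinity in the chart at `p`, with radius `ε`.**
Verbatim packaging of the matrix of `stmt-SmoothPoincare4-0427`: `0 < ε`; `sf` is a smooth
(`IsSmoothForm`), closed (`IsClosedForm`), pointwise nondegenerate `2`-form on `M ∖ {p}`; and for
every `x` in the punctured chart-ball of radius `ε` and all tangent vectors `v, w`,
`sf x (v, w) = (ι*ω₀)_{e x - e p}(De_x v, De_x w)` where `e = extChartAt (𝓡 4) p` and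
`De_x = mfderiv (𝓡 4) 𝓘(ℝ, ℝ⁴) (e ∘ Subtype.val) x`.
[cite: Gromov1985, §0.3.C] [cite: McDuffSalamon2012, §9.4] -/
def IsSymplecticStandardNearPoint (p : M) (ε : ℝ) (sf : Literature.Geometry.Kaehler.MForm (𝓡 4) (punctured p) ℝ 2) :
    Prop :=
  0 < ε ∧ Literature.Geometry.Kaehler.IsSmoothForm sf ∧ Literature.Geometry.Kaehler.IsClosedForm sf ∧
    (∀ x (v : TangentSpace (𝓡 4) x), v ≠ 0 → ∃ w, sf x ![v, w] ≠ 0) ∧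
    ∀ (x : punctured p), x.1 ∈ (chartAt E4 p).source →
      extChartAt (𝓡 4) p x.1 ∈ Metric.ball (extChartAt (𝓡 4) p p) ε → ∀ v w,
        sf x ![v, w] = invertedStdForm (extChartAt (𝓡 4) p x.1 - extChartAt (𝓡 4) p p)
          (mfderiv (𝓡 4) 𝓘(ℝ, E4) (fun z : punctured p => extChartAt (𝓡 4) p z.1) x v)
          (mfderiv (𝓡 4) 𝓘(ℝ, E4) (fun z : punctured p => extChartAt (𝓡 4) p z.1) x w)

/-- **`Φ` agrees with the inverted recentred chart near the puncture**: there is `ε > 0` such that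
`Φ x = ι (e x - e p)` for every `x` in the punctured chart-ball of radius `ε` (glue crux of route
`SymplecticCap`). [cite: Gromov1985, §0.3.C] -/
def AgreesWithInvertedChartNear (p : M) (Φ : punctured p → E4) : Prop :=
  ∃ ε : ℝ, 0 < ε ∧ ∀ x : punctured p, x.1 ∈ (chartAt E4 p).source →
    extChartAt (𝓡 4) p x.1 ∈ Metric.ball (extChartAt (𝓡 4) p p) ε →
      Φ x = inversion (extChartAt (𝓡 4) p x.1 - extChartAt (𝓡 4) p p)

/-! ### API -/

variable {p : M} {ε : ℝ} {sf : Literature.Geometry.Kaehler.MForm (𝓡 4) (punctured p) ℝ 2}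

/-- Unfolding to the verbatim conjunction of `stmt-SmoothPoincare4-0427` (with `invertedStdForm`
and `stdSymplecticForm` themselves unfolding by `rfl` to the explicit lambda terms there).
[folklore] -/
theorem isSymplecticStandardNearPoint_iff :
    IsSymplecticStandardNearPoint p ε sf ↔
      0 < ε ∧ Literature.Geometry.Kaehler.IsSmoothForm sf ∧ Literature.Geometry.Kaehler.IsClosedForm sf ∧
      (∀ x (v : TangentSpace (𝓡 4) x), v ≠ 0 → ∃ w, sf x ![v, w] ≠ 0) ∧
      ∀ (x : punctured p), x.1 ∈ (chartAt E4 p).source →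
        extChartAt (𝓡 4) p x.1 ∈ Metric.ball (extChartAt (𝓡 4) p p) ε → ∀ v w,
          sf x ![v, w] = (fun (y a b : E4) =>
              (fun a' b' : E4 => a' 0 * b' 1 - a' 1 * b' 0 + a' 2 * b' 3 - a' 3 * b' 2)
                (fderiv ℝ (fun z : E4 => (‖z‖ ^ 2)⁻¹ • z) y a)
                (fderiv ℝ (fun z : E4 => (‖z‖ ^ 2)⁻¹ • z) y b))
            (extChartAt (𝓡 4) p x.1 - extChartAt (𝓡 4) p p)
            (mfderiv (𝓡 4) 𝓘(ℝ, E4) (fun z : punctured p => extChartAt (𝓡 4) p z.1) x v)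
            (mfderiv (𝓡 4) 𝓘(ℝ, E4) (fun z : punctured p => extChartAt (𝓡 4) p z.1) x w) :=
  Iff.rfl

/-- Projections. [folklore] -/
theorem IsSymplecticStandardNearPoint.pos (h : IsSymplecticStandardNearPoint p ε sf) : 0 < ε :=
  h.1

/-- A form standard near `p` is smooth. [folklore] -/
theorem IsSymplecticStandardNearPoint.isSmoothForm (h : IsSymplecticStandardNearPoint p ε sf) :
    Literature.Geometry.Kaehler.IsSmoothForm sf :=
  h.2.1

/-- A form standard near `p` is closed. [folklore] -/
theorem IsSymplecticStandardNearPoint.isClosedForm (h : IsSymplecticStandardNearPoint p ε sf) :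
    Literature.Geometry.Kaehler.IsClosedForm sf :=
  h.2.2.1

/-- A form standard near `p` is pointwise nondegenerate. [folklore] -/
theorem IsSymplecticStandardNearPoint.nondegenerate (h : IsSymplecticStandardNearPoint p ε sf)
    (x : punctured p) (v : TangentSpace (𝓡 4) x) (hv : v ≠ 0) : ∃ w, sf x ![v, w] ≠ 0 :=
  h.2.2.2.1 x v hv

/-- The end condition, in terms of `InPuncturedChartBall` and `invertedStdForm`. [folklore] -/
theorem IsSymplecticStandardNearPoint.eq_invertedStdForm
    (h : IsSymplecticStandardNearPoint p ε sf) {x : punctured p}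
    (hx : InPuncturedChartBall p ε x) (v w : TangentSpace (𝓡 4) x) :
    sf x ![v, w] = invertedStdForm (extChartAt (𝓡 4) p x.1 - extChartAt (𝓡 4) p p)
      (mfderiv (𝓡 4) 𝓘(ℝ, E4) (fun z : punctured p => extChartAt (𝓡 4) p z.1) x v)
      (mfderiv (𝓡 4) 𝓘(ℝ, E4) (fun z : punctured p => extChartAt (𝓡 4) p z.1) x w) :=
  h.2.2.2.2 x hx.1 hx.2 v w

/-- Shrinking the radius preserves the property (the end condition is asked on a smaller ball).
[folklore] -/
theorem IsSymplecticStandardNearPoint.mono (h : IsSymplecticStandardNearPoint p ε sf) {ε' : ℝ}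
    (hε' : 0 < ε') (hle : ε' ≤ ε) : IsSymplecticStandardNearPoint p ε' sf :=
  ⟨hε', h.2.1, h.2.2.1, h.2.2.2.1,
    fun x hs hb v w => h.2.2.2.2 x hs (Metric.ball_subset_ball hle hb) v w⟩

/-- `AgreesWithInvertedChartNear` from an explicit radius. [folklore] -/
theorem agreesWithInvertedChartNear_of {Φ : punctured p → E4} (hε : 0 < ε)
    (h : ∀ x : punctured p, InPuncturedChartBall p ε x →
      Φ x = inversion (extChartAt (𝓡 4) p x.1 - extChartAt (𝓡 4) p p)) :
    AgreesWithInvertedChartNear p Φ :=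
  ⟨ε, hε, fun x hs hb => h x ⟨hs, hb⟩⟩

end Literature.Geometry.Symplectic
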